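import Summits.CriticalPhenomena.PercolationContinuityZ3.Theorems.PercNearOneGluingNoHeavyLowerTailSahiThreeCopyCellX6dp111222Data1
import Summits.CriticalPhenomena.PercolationContinuityZ3.Theorems.PercNearOneGluingNoHeavyLowerTailSahiThreeCopyCellSlotFamilies

/-!
# `NoHeavyLowerTail` (crux stmt-CriticalPhenomena-4575), Sahi programme: **`LawGood 6 (prof6 56) 1_{X6d}` — the slot `X6d = (x₀∨x₁)∧(x₂∨x₃), x₄ x₅ dummies`
# at the front profile class `111222`** (law-level cell certificates with square terms; 3 certified cells, the other ordered cells by symmetry)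

Support file (Sahi cell, seat `prim-sahi-p1`, generation 65; `--supports stmt-CriticalPhenomena-4575`).  COMPUTATIONAL: `native_decide` evaluations of
`checkCellSq` (one per certified cell) and of `symCheck`; everything else standard axioms.  Certificates: Γ-invariant cell LPs with the 8 non-flow square
rays on pairs of 2-faces found by column generation (kit j345653–j345661), exact rational solutions verified on the full system; data in `…CellX6dp111222Data*`.
Role in the programme: a boundary section of `C₈` (memo §6, `…CellAssembly`, `…CellSections`). [this work]
-/

namespace Summit.CriticalPhenomena.PercolationContinuityZ3.Theorems.SahiThreeCopy

open Finset Function Literature.Combinatorics.Sahi2008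
open scoped BigOperators

/-- ★ (computational, `native_decide`) The expanded certificate for cell `(0,0)` of `X6d111222` passes `checkCellSq`. [this work] -/
theorem checkX6d111222_00 :
    checkCellSq 6 (prof6 56) x6dZ (transScore blocksX6d) 2 0 0 certX6d111222_00.base.expand certX6d111222_00.expandSq = true := by
  native_decide

/-- ★ (computational, `native_decide`) The expanded certificate for cell `(0,1)` of `X6d111222` passes `checkCellSq`. [this work] -/
theorem checkX6d111222_01 :
    checkCellSq 6 (prof6 56) x6dZ (transScore blocksX6d) 2 0 1 certX6d111222_01.base.expand certX6d111222_01.expandSq = true := by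
  native_decide

/-- ★ (computational, `native_decide`) The expanded certificate for cell `(1,1)` of `X6d111222` passes `checkCellSq`. [this work] -/
theorem checkX6d111222_11 :
    checkCellSq 6 (prof6 56) x6dZ (transScore blocksX6d) 2 1 1 certX6d111222_11.base.expand certX6d111222_11.expandSq = true := by
  native_decide

/-- Cell facts exist for the ordered cell `(p, q)` of `X6d111222`. [this work] -/
def X6d111222CellOK (p q : ℕ) : Prop :=
  ∃ θ, CellFacts 6 (prof6 56) (fun x => (x6dZ x : ℝ)) 2 (fun j e => ((transScore blocksX6d) j e : ℝ)) p q θ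

/-- Transposed cells. [this work] -/
theorem X6d111222cell_transpose {p q : ℕ} (h : X6d111222CellOK p q) : X6d111222CellOK q p := by
  obtain ⟨θ, hθ⟩ := h; exact ⟨θ, cellFacts_transpose hθ⟩

/-- ★ Cell facts for ALL 4 ordered cells of `X6d111222` (certificates, transport along the checked symmetries, transposition). [this work] -/
theorem X6d111222cell_all : ∀ p q, p < 2 → q < 2 → X6d111222CellOK p q := by
  have c00 : X6d111222CellOK 0 0 := ⟨_, cellFacts_of_checkCellSq checkX6d111222_00⟩
  have c01 : X6d111222CellOK 0 1 := ⟨_, cellFacts_of_checkCellSq checkX6d111222_01⟩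
  have c10 : X6d111222CellOK 1 0 := X6d111222cell_transpose c01
  have c11 : X6d111222CellOK 1 1 := ⟨_, cellFacts_of_checkCellSq checkX6d111222_11⟩
  intro p q hp hq
  interval_cases p <;> interval_cases q
  exacts [c00, c01, c10, c11]

/-- ★★ `PointwiseTP` for `X6d111222`. [this work] -/
theorem pointwiseTP_X6d111222 : PointwiseTP 6 (prof6 56) (setInd X6dSet) := by
  rw [setInd_X6dSet_eq]; exact pointwiseTP_of_exists_cellFacts (by norm_num) _ X6d111222cell_all

/-- ★★ `LawGood` for `X6d111222`: law-level all-back positivity at this front profile. [this work] -/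
theorem lawGood_X6d111222 : LawGood 6 (prof6 56) (setInd X6dSet) :=
  lawGood_of_pointwiseTP pointwiseTP_X6d111222

end Summit.CriticalPhenomena.PercolationContinuityZ3.Theorems.SahiThreeCopy
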